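import Summits.CriticalPhenomena.PercolationContinuityZ3.Theorems.Transplant.FKThreeApexWordTri
import Summits.CriticalPhenomena.PercolationContinuityZ3.Theorems.Transplant.FKConnectivityAllQWheelNegCorr
import HarnessLib

/-!
# Connectivity correlation inequalities for `φ_{w,q}` — PINNED RAYLEIGH ⇒ NEGATIVE CORRELATION (general), and the pinning tools of `K_{1,1,1,n}`

Support file (`--supports stmt-CriticalPhenomena-4575`), FK sub-lane `prim-bschramm-fk-3` (gen 13); builds on p205010 (kernel theorem, internal audit
signed; external expert review pending).  No named facts, no sorries; standard axioms.  Layer 3c-i of the `K_{1,1,1,n}` programme (memo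
`bschramm/prim-bschramm-fk-3/THREE-APEX.md` §6).
* **`negCorr_of_pinned_rayleigh`** (ANY finite weighted graph, any `q > 0`, pairs `e ≠ f`): if the four partition functions with `e, f` pinned
  satisfy the Rayleigh inequality `Z¹¹·Z⁰⁰ ≤ Z¹⁰·Z⁰¹` then `φ_{w,q}(J_e ∩ J_f) ≤ φ_{w,q}(J_e)·φ_{w,q}(J_f)`.  (Bi-affinity of `Z` in the two pair
  parameters, `rcPartitionFunctionW_biaffine`, and `S(J_e) = w_e·Z_{w[e↦1]}`: the covariance numerator is `w_e w_f (1−w_e)(1−w_f)·(Z¹⁰Z⁰¹ − Z¹¹Z⁰⁰)`.)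
* Pinning tools for the weighted `K_{1,1,1,n}` (setting of `…ThreeApexWordTri`): the leaf product with one leaf re-pinned on two of its edges
  (`zvec_pin_leaf`) or two leaves re-pinned on their `a`-edges (`zvec_pin_two`), the triangle letters under re-pinning (`triLetter_pin_*`), membership of
  the triangle letters in the three-apex monoid (`inK_triLetter`, …), and the invariance of `fullPairs` under relabelling the apices.
[cite: Grimmett2006, §1.4 eq. (1.20) (p. 15); §3.9 eq. (3.94) (pp. 63–64)] [folklore]
-/

noncomputable section

namespace Summit.CriticalPhenomena.PercolationContinuityZ3.Theorems

namespace FK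

open Literature.Probability.LatticeModels Literature.Probability.Percolation
open Literature.Probability.Percolation.DecisionTree (ind ind_of_mem ind_of_not_mem ind_nonneg)
open scoped Classical

variable {V : Type*} [Fintype V]

/-! ### Pinned Rayleigh ⇒ negative correlation -/

/-- **Bi-affinity of the partition function in two pair parameters**: for `f ≠ e` and `σ, τ ∈ [0,1]`,
`Z_{w[e↦σ][f↦τ]} = (1−σ)(1−τ)Z⁰⁰ + σ(1−τ)Z¹⁰ + (1−σ)τZ⁰¹ + στZ¹¹`. [cite: Grimmett2006, §1.4 eq. (1.20) (p. 15)] -/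
theorem rcPartitionFunctionW_biaffine (w : Sym2 V → unitInterval) (q : ℝ) {e f : Sym2 V} (hfe : f ≠ e) (σ τ : unitInterval) :
    rcPartitionFunctionW (Function.update (Function.update w e σ) f τ) q ∅ =
      (1 - (σ : ℝ)) * (1 - (τ : ℝ)) * rcPartitionFunctionW (Function.update (Function.update w e 0) f 0) q ∅ +
        (σ : ℝ) * (1 - (τ : ℝ)) * rcPartitionFunctionW (Function.update (Function.update w e 1) f 0) q ∅ +
        (1 - (σ : ℝ)) * (τ : ℝ) * rcPartitionFunctionW (Function.update (Function.update w e 0) f 1) q ∅ +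
        (σ : ℝ) * (τ : ℝ) * rcPartitionFunctionW (Function.update (Function.update w e 1) f 1) q ∅ := by
  -- affinity in `f`, then in `e` (the updates commute since `f ≠ e`)
  have hf : ∀ σ' : unitInterval, rcPartitionFunctionW (Function.update (Function.update w e σ') f τ) q ∅ =
      (1 - (τ : ℝ)) * rcPartitionFunctionW (Function.update (Function.update w e σ') f 0) q ∅ +
        (τ : ℝ) * rcPartitionFunctionW (Function.update (Function.update w e σ') f 1) q ∅ := by
    intro σ'
    have h := rcPartitionFunctionW_affine (Function.update (Function.update w e σ') f τ) q f
    simp only [Function.update_self, Function.update_idem] at h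
    exact h
  have he : ∀ τ' : unitInterval, rcPartitionFunctionW (Function.update (Function.update w e σ) f τ') q ∅ =
      (1 - (σ : ℝ)) * rcPartitionFunctionW (Function.update (Function.update w e 0) f τ') q ∅ +
        (σ : ℝ) * rcPartitionFunctionW (Function.update (Function.update w e 1) f τ') q ∅ := by
    intro τ'
    have hupd : ∀ ρ : unitInterval,
        Function.update (Function.update (Function.update w e σ) f τ') e ρ = Function.update (Function.update w e ρ) f τ' := by
      intro ρ
      rw [Function.update_comm hfe.symm, Function.update_idem, Function.update_comm hfe]
    have h := rcPartitionFunctionW_affine (Function.update (Function.update w e σ) f τ') q e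
    rw [Function.update_of_ne hfe.symm, Function.update_self, hupd 0, hupd 1] at h
    exact h
  rw [hf σ, he 0, he 1]
  ring

/-- **Pinned Rayleigh ⇒ negative correlation.**  For any finite weighted graph, `0 < q`, pairs `f ≠ e`: if
`Z_{w[e↦1][f↦1]}·Z_{w[e↦0][f↦0]} ≤ Z_{w[e↦1][f↦0]}·Z_{w[e↦0][f↦1]}` then `φ_{w,q}(J_e ∩ J_f) ≤ φ_{w,q}(J_e)·φ_{w,q}(J_f)`.
[cite: Grimmett2006, §3.9 eq. (3.94) (pp. 63–64); §1.4 eq. (1.20) (p. 15)] -/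
theorem negCorr_of_pinned_rayleigh (w : Sym2 V → unitInterval) {q : ℝ} (hq0 : 0 < q) {e f : Sym2 V} (hfe : f ≠ e)
    (h : rcPartitionFunctionW (Function.update (Function.update w e 1) f 1) q ∅ *
        rcPartitionFunctionW (Function.update (Function.update w e 0) f 0) q ∅ ≤
      rcPartitionFunctionW (Function.update (Function.update w e 1) f 0) q ∅ *
        rcPartitionFunctionW (Function.update (Function.update w e 0) f 1) q ∅) :
    (rcMeasureW w q ∅).real ({ω : BondConfig V | e ∈ ω} ∩ {ω | f ∈ ω}) ≤
      (rcMeasureW w q ∅).real {ω : BondConfig V | e ∈ ω} * (rcMeasureW w q ∅).real {ω : BondConfig V | f ∈ ω} := by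
  have hs0 : 0 ≤ ((w e : unitInterval) : ℝ) := (w _).2.1
  have hs1 : ((w e : unitInterval) : ℝ) ≤ 1 := (w _).2.2
  have ht0 : 0 ≤ ((w f : unitInterval) : ℝ) := (w _).2.1
  have ht1 : ((w f : unitInterval) : ℝ) ≤ 1 := (w _).2.2
  -- masses through pinned partition functions
  have hZw : rcPartitionFunctionW w q ∅ = rcPartitionFunctionW (Function.update (Function.update w e (w e)) f (w f)) q ∅ := by
    rw [Function.update_eq_self, Function.update_eq_self]
  have hSe : ∑ ω : BondConfig V, rcWeightW w q ∅ ω * ind {ω : BondConfig V | e ∈ ω} ω =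
      ((w e : unitInterval) : ℝ) * rcPartitionFunctionW (Function.update (Function.update w e 1) f (w f)) q ∅ := by
    rw [Wheel.sum_openPair_eq_mul_Z w q e]
    congr 2
    conv_lhs => rw [← Function.update_eq_self f (Function.update w e 1)]
    rw [Function.update_of_ne hfe]
  have hSf : ∑ ω : BondConfig V, rcWeightW w q ∅ ω * ind {ω : BondConfig V | f ∈ ω} ω =
      ((w f : unitInterval) : ℝ) * rcPartitionFunctionW (Function.update (Function.update w e (w e)) f 1) q ∅ := by
    rw [Wheel.sum_openPair_eq_mul_Z w q f, Function.update_eq_self]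
  have hSef : ∑ ω : BondConfig V, rcWeightW w q ∅ ω * ind ({ω : BondConfig V | e ∈ ω} ∩ {ω | f ∈ ω}) ω =
      ((w e : unitInterval) : ℝ) * ((w f : unitInterval) : ℝ) * rcPartitionFunctionW (Function.update (Function.update w e 1) f 1) q ∅ :=
    Wheel.sum_openPair_inter_openPair_eq w q hfe
  have hB := fun (σ τ : unitInterval) => rcPartitionFunctionW_biaffine w q hfe σ τ
  have hnn : 0 ≤ ((w e : unitInterval) : ℝ) * ((w f : unitInterval) : ℝ) *
      ((1 - ((w e : unitInterval) : ℝ)) * (1 - ((w f : unitInterval) : ℝ))) *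
      (rcPartitionFunctionW (Function.update (Function.update w e 1) f 0) q ∅ *
          rcPartitionFunctionW (Function.update (Function.update w e 0) f 1) q ∅ -
        rcPartitionFunctionW (Function.update (Function.update w e 1) f 1) q ∅ *
          rcPartitionFunctionW (Function.update (Function.update w e 0) f 0) q ∅) :=
    mul_nonneg (mul_nonneg (mul_nonneg hs0 ht0) (mul_nonneg (sub_nonneg.2 hs1) (sub_nonneg.2 ht1))) (sub_nonneg.2 h)
  have key : ∀ (s t Z00 Z10 Z01 Z11 : ℝ),
      (s * ((1 - 1) * (1 - t) * Z00 + 1 * (1 - t) * Z10 + (1 - 1) * t * Z01 + 1 * t * Z11)) *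
          (t * ((1 - s) * (1 - 1) * Z00 + s * (1 - 1) * Z10 + (1 - s) * 1 * Z01 + s * 1 * Z11)) -
        (s * t * Z11) * ((1 - s) * (1 - t) * Z00 + s * (1 - t) * Z10 + (1 - s) * t * Z01 + s * t * Z11) =
      s * t * ((1 - s) * (1 - t)) * (Z10 * Z01 - Z11 * Z00) := by
    intro s t Z00 Z10 Z01 Z11; ring
  have main : (∑ ω : BondConfig V, rcWeightW w q ∅ ω * ind ({ω : BondConfig V | e ∈ ω} ∩ {ω | f ∈ ω}) ω) * rcPartitionFunctionW w q ∅ ≤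
      (∑ ω : BondConfig V, rcWeightW w q ∅ ω * ind {ω : BondConfig V | e ∈ ω} ω) *
        ∑ ω : BondConfig V, rcWeightW w q ∅ ω * ind {ω : BondConfig V | f ∈ ω} ω := by
    rw [hSef, hSe, hSf, hZw, hB 1 (w f), hB (w e) 1, hB (w e) (w f), Set.Icc.coe_one]
    have k := key ((w e : unitInterval) : ℝ) ((w f : unitInterval) : ℝ)
      (rcPartitionFunctionW (Function.update (Function.update w e 0) f 0) q ∅)
      (rcPartitionFunctionW (Function.update (Function.update w e 1) f 0) q ∅)
      (rcPartitionFunctionW (Function.update (Function.update w e 0) f 1) q ∅)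
      (rcPartitionFunctionW (Function.update (Function.update w e 1) f 1) q ∅)
    nlinarith [k, hnn]
  have hZpos := rcPartitionFunctionW_pos w hq0 (∅ : Set V)
  rw [rcMeasureW_real_eq_sum_div w hq0, rcMeasureW_real_eq_sum_div w hq0, rcMeasureW_real_eq_sum_div w hq0, div_mul_div_comm,
    div_le_div_iff₀ hZpos (mul_pos hZpos hZpos)]
  nlinarith [mul_le_mul_of_nonneg_right main hZpos.le]

namespace ThreeApex

/-! ### The triangle letters lie in the three-apex monoid -/

omit [Fintype V] in
/-- The triangle letters are a product of admissible edge letters. [folklore] -/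
theorem inK_triLetter (q : ℝ) (w : Sym2 V → unitInterval) (a b c : V) : InK q (triLetter w a b c) :=
  (IsLetter.ab (q := q) (w _).2.1 (w _).2.2).inK.mul
    ((IsLetter.ac (q := q) (w _).2.1 (w _).2.2).inK.mul (IsLetter.bc (q := q) (w _).2.1 (w _).2.2).inK)

/-! ### Relabelling the apices -/

omit [Fintype V] in
/-- `triPairs` is symmetric in the last two apices. [folklore] -/
theorem triPairs_swap₂₃ (a b c : V) : triPairs a c b = triPairs a b c := by
  ext e; simp only [mem_triPairs_iff, Sym2.eq_swap (a := c) (b := b)]; tauto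

omit [Fintype V] in
/-- `triPairs` is invariant under rotating the apices. [folklore] -/
theorem triPairs_rotate (a b c : V) : triPairs b c a = triPairs a b c := by
  ext e; simp only [mem_triPairs_iff, Sym2.eq_swap (a := c) (b := a), Sym2.eq_swap (a := b) (b := a)]; tauto

omit [Fintype V] in
/-- `fullPairs` is symmetric in the last two apices. [folklore] -/
theorem fullPairs_swap₂₃ (a b c : V) (v : ℕ → V) (n : ℕ) : fullPairs a c b v n = fullPairs a b c v n := by
  rw [fullPairs, fullPairs, apexPairs_swap₂₃, triPairs_swap₂₃]

omit [Fintype V] in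
/-- `fullPairs` is invariant under rotating the apices. [folklore] -/
theorem fullPairs_rotate (a b c : V) (v : ℕ → V) (n : ℕ) : fullPairs b c a v n = fullPairs a b c v n := by
  rw [fullPairs, fullPairs, apexPairs_rotate, triPairs_rotate]

omit [Fintype V] in
/-- `fullPairs` is symmetric in the first two apices. [folklore] -/
theorem fullPairs_swap₁₂ (a b c : V) (v : ℕ → V) (n : ℕ) : fullPairs b a c v n = fullPairs a b c v n := by
  rw [← fullPairs_rotate b a c, fullPairs_swap₂₃]

/-! ### Pinning tools in the setting of `K_{1,1,1,n}` -/

section Setting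

variable {a b c : V} {v : ℕ → V} {n : ℕ}
variable (hab : a ≠ b) (hac : a ≠ c) (hbc : b ≠ c) (hinj : ∀ j k, j < n → k < n → v j = v k → j = k)
  (hva : ∀ j, j < n → v j ≠ a) (hvb : ∀ j, j < n → v j ≠ b) (hvc : ∀ j, j < n → v j ≠ c)
include hab hac hbc hinj hva hvb hvc

omit [Fintype V] hab hac hbc hinj hva hvb hvc in
/-- Re-pinning pairs of `fullPairs` keeps the support inside `fullPairs`. [folklore] -/
theorem supp_update_fullPair (w : Sym2 V → unitInterval) (hsupp : ∀ e, e ∉ fullPairs a b c v n → w e = 0) {e : Sym2 V}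
    (he : e ∈ fullPairs a b c v n) (σ : unitInterval) : ∀ g, g ∉ fullPairs a b c v n → Function.update w e σ g = 0 := by
  intro g hg
  have hne : g ≠ e := fun h => hg (h ▸ he)
  rw [Function.update_of_ne hne]
  exact hsupp g hg

omit [Fintype V] hab hac hbc hinj hva hvb hvc in
/-- Apex–leaf pairs and triangle pairs belong to `fullPairs`. [folklore] -/
theorem mem_fullPairs_of {e : Sym2 V} (h : e ∈ apexPairs a b c v n ∨ e ∈ triPairs a b c) : e ∈ fullPairs a b c v n :=
  (mem_fullPairs_iff a b c v n e).2 h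

omit [Fintype V] in
/-- **One leaf re-pinned on two of its edges**: the leaf product is `leaf q σ τ c₀ ·` (the other leaves). [folklore] -/
theorem zvec_pin_leaf (q : ℝ) (w : Sym2 V → unitInterval) {j₀ : ℕ} (hj₀ : j₀ < n) (σ τ : unitInterval) :
    zvec q (Function.update (Function.update w s(a, v j₀) σ) s(b, v j₀) τ) a b c v n =
      leaf q (σ : ℝ) (τ : ℝ) ((w s(c, v j₀) : unitInterval) : ℝ) * ∏ j ∈ (Finset.range n).erase j₀, leafOf q w a b c (v j) := by
  obtain ⟨nab, nac, nbc⟩ := pairs_at_leaf_ne hab hac hbc hva hvb hj₀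
  rw [zvec_pin_one hinj hva hvb hvc q _ b hj₀ τ]
  congr 1
  · simp only [leafOf, Function.update_self, Function.update_of_ne nab, Function.update_of_ne nbc.symm,
      Function.update_of_ne nac.symm]
  · refine Finset.prod_congr rfl fun j hj => ?_
    have hj' : j ≠ j₀ ∧ j < n := by simpa [Finset.mem_erase, Finset.mem_range] using hj
    exact leafOf_update_of_ne hinj hva hvb hvc q w a hj₀ hj'.2 hj'.1 σ

omit [Fintype V] in
/-- **Two leaves re-pinned on their `a`-edges**: the leaf product is `leaf q σ b₁ c₁ · leaf q τ b₂ c₂ ·` (the other leaves). [folklore] -/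
theorem zvec_pin_two (q : ℝ) (w : Sym2 V → unitInterval) {j₁ j₂ : ℕ} (hj₁ : j₁ < n) (hj₂ : j₂ < n) (hne : j₁ ≠ j₂)
    (σ τ : unitInterval) :
    zvec q (Function.update (Function.update w s(a, v j₁) σ) s(a, v j₂) τ) a b c v n =
      leaf q (σ : ℝ) ((w s(b, v j₁) : unitInterval) : ℝ) ((w s(c, v j₁) : unitInterval) : ℝ) *
        (leaf q (τ : ℝ) ((w s(b, v j₂) : unitInterval) : ℝ) ((w s(c, v j₂) : unitInterval) : ℝ) *
          ∏ j ∈ ((Finset.range n).erase j₁).erase j₂, leafOf q w a b c (v j)) := by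
  obtain ⟨nab₁, nac₁, -⟩ := pairs_at_leaf_ne hab hac hbc hva hvb hj₁
  obtain ⟨nab₂, nac₂, -⟩ := pairs_at_leaf_ne hab hac hbc hva hvb hj₂
  have hmem₁ : j₁ ∈ Finset.range n := Finset.mem_range.2 hj₁
  have hmem₂ : j₂ ∈ (Finset.range n).erase j₁ := Finset.mem_erase.2 ⟨fun h => hne h.symm, Finset.mem_range.2 hj₂⟩
  have haa : s(a, v j₁) ≠ s(a, v j₂) := pair_ne_of_ne hinj hva hvb hvc (x := a) (y := a) (Or.inl rfl) hj₁ hj₂ hne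
  have hba : s(b, v j₁) ≠ s(a, v j₂) := pair_ne_of_ne hinj hva hvb hvc (x := b) (y := a) (Or.inr (Or.inl rfl)) hj₁ hj₂ hne
  have hca : s(c, v j₁) ≠ s(a, v j₂) := pair_ne_of_ne hinj hva hvb hvc (x := c) (y := a) (Or.inr (Or.inr rfl)) hj₁ hj₂ hne
  have hba' : s(b, v j₂) ≠ s(a, v j₁) := pair_ne_of_ne hinj hva hvb hvc (x := b) (y := a) (Or.inr (Or.inl rfl)) hj₂ hj₁ (Ne.symm hne)
  have hca' : s(c, v j₂) ≠ s(a, v j₁) := pair_ne_of_ne hinj hva hvb hvc (x := c) (y := a) (Or.inr (Or.inr rfl)) hj₂ hj₁ (Ne.symm hne)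
  rw [zvec_eq_prod, ← Finset.mul_prod_erase _ _ hmem₁, ← Finset.mul_prod_erase _ _ hmem₂]
  congr 1
  · simp only [leafOf, Function.update_of_ne haa, Function.update_self, Function.update_of_ne hba, Function.update_of_ne nab₁.symm,
      Function.update_of_ne hca, Function.update_of_ne nac₁.symm]
  · congr 1
    · simp only [leafOf, Function.update_self, Function.update_of_ne nab₂.symm, Function.update_of_ne hba',
        Function.update_of_ne nac₂.symm, Function.update_of_ne hca']
    · refine Finset.prod_congr rfl fun j hj => ?_
      have hj' : j ≠ j₂ ∧ j ≠ j₁ ∧ j < n := by simpa [Finset.mem_erase, Finset.mem_range] using hj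
      rw [leafOf_update_of_ne hinj hva hvb hvc q _ a hj₂ hj'.2.2 hj'.1 τ, leafOf_update_of_ne hinj hva hvb hvc q w a hj₁ hj'.2.2 hj'.2.1 σ]

omit [Fintype V] hab hac hbc hinj in
/-- Re-pinning two pairs at leaves does not change the triangle letters. [folklore] -/
theorem triLetter_pin_leaves (w : Sym2 V → unitInterval) (x y : V) {j₁ j₂ : ℕ} (hj₁ : j₁ < n) (hj₂ : j₂ < n) (σ τ : unitInterval) :
    triLetter (Function.update (Function.update w s(x, v j₁) σ) s(y, v j₂) τ) a b c = triLetter w a b c := by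
  rw [triLetter_update_apexPair hva hvb hvc _ y hj₂ τ, triLetter_update_apexPair hva hvb hvc w x hj₁ σ]

omit [Fintype V] hinj in
/-- Re-pinning the `a`-edge of a leaf and the triangle edge `ab`: the triangle letters become `edgeAB τ · edgeAC · edgeBC`. [folklore] -/
theorem triLetter_pin_leaf_ab (w : Sym2 V → unitInterval) {j₀ : ℕ} (hj₀ : j₀ < n) (σ τ : unitInterval) :
    triLetter (Function.update (Function.update w s(a, v j₀) σ) s(a, b) τ) a b c =
      edgeAB (τ : ℝ) * (edgeAC ((w s(a, c) : unitInterval) : ℝ) * edgeBC ((w s(b, c) : unitInterval) : ℝ)) := by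
  obtain ⟨n12, n13, -⟩ := triPairs_ne hab hac hbc (V := V)
  obtain ⟨-, m2, m3⟩ := apexPair_ne_tri hva hvb hvc a hj₀
  simp only [triLetter, Function.update_self, Function.update_of_ne n12.symm, Function.update_of_ne n13.symm,
    Function.update_of_ne m2.symm, Function.update_of_ne m3.symm]

omit [Fintype V] hinj hva hvb hvc in
/-- Re-pinning the triangle edges `ab` and `bc`: the triangle letters become `edgeAB σ · edgeAC · edgeBC τ`. [folklore] -/
theorem triLetter_pin_ab_bc (w : Sym2 V → unitInterval) (σ τ : unitInterval) :
    triLetter (Function.update (Function.update w s(a, b) σ) s(b, c) τ) a b c =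
      edgeAB (σ : ℝ) * (edgeAC ((w s(a, c) : unitInterval) : ℝ) * edgeBC (τ : ℝ)) := by
  obtain ⟨n12, n13, n23⟩ := triPairs_ne hab hac hbc (V := V)
  simp only [triLetter, Function.update_self, Function.update_of_ne n13, Function.update_of_ne n23, Function.update_of_ne n12.symm]

omit [Fintype V] in
/-- Re-pinning the `a`-edge of a leaf and then a triangle pair does not change the leaf product beyond the leaf pin. [folklore] -/
theorem zvec_pin_leaf_tri (q : ℝ) (w : Sym2 V → unitInterval) {e : Sym2 V} (he : e ∈ triPairs a b c) {j₀ : ℕ} (hj₀ : j₀ < n)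
    (σ τ : unitInterval) :
    zvec q (Function.update (Function.update w s(a, v j₀) σ) e τ) a b c v n =
      leaf q (σ : ℝ) ((w s(b, v j₀) : unitInterval) : ℝ) ((w s(c, v j₀) : unitInterval) : ℝ) *
        ∏ j ∈ (Finset.range n).erase j₀, leafOf q w a b c (v j) := by
  obtain ⟨nab, nac, -⟩ := pairs_at_leaf_ne hab hac hbc hva hvb hj₀
  rw [zvec_update_tri hva hvb hvc q _ he τ, zvec_pin_one hinj hva hvb hvc q w a hj₀ σ]
  congr 1
  simp only [leafOf, Function.update_self, Function.update_of_ne nab.symm, Function.update_of_ne nac.symm]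

omit [Fintype V] hab hac hbc hinj in
/-- Re-pinning two triangle pairs does not change the leaf product. [folklore] -/
theorem zvec_pin_tri_tri (q : ℝ) (w : Sym2 V → unitInterval) {e f : Sym2 V} (he : e ∈ triPairs a b c) (hf : f ∈ triPairs a b c)
    (σ τ : unitInterval) :
    zvec q (Function.update (Function.update w e σ) f τ) a b c v n = zvec q w a b c v n := by
  rw [zvec_update_tri hva hvb hvc q _ hf τ, zvec_update_tri hva hvb hvc q w he σ]

end Setting

end ThreeApex

end FK

end Summit.CriticalPhenomena.PercolationContinuityZ3.Theorems

end
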